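import Literature.MathematicalPhysics.QuantumLattice.FermionicPEPS
import Literature.MathematicalPhysics.QuantumLattice.ProductOperators
import Literature.MathematicalPhysics.QuantumLattice.FermionOperatorsProofs
import HarnessLib

/-!
# The site-major Jordan–Wigner identification `ℓ²(𝒫(Orb Λ)) ≅ (ℂ⁴)^{⊗Λ}` for Hubbard-type fermions

Topic `MathematicalPhysics/QuantumLattice`; namespace
`Literature.MathematicalPhysics.QuantumLattice.JordanWigner`. Everything in this file is a
DEFINITION with a body or a PROVED theorem; no named fact is introduced.

The tree models the fermionic Fock space over the orbitals `Orb Λ = Λ ×ₗ Fin 2` (site-major,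
spin `0 = ↑` before `1 = ↓`) as `Fock (Orb Λ) = Finset (Orb Λ) → ℂ` with the Jordan–Wigner
matrices `annihilation`, `creation` (`HubbardWave0`: `c_i |insert i s⟩ = (-1)^{#{j ∈ s : j < i}} |s⟩`),
and a quantum spin system with `q` states per site as `Op Λ q = Matrix (Λ → Fin q) (Λ → Fin q) ℂ`
(`SpinSystem`, `ProductOperators`: `onSite`, `productOp`). This file identifies the two for `q = 4`:

* `JordanWigner.config k` / `JordanWigner.configEquiv : TensorIndex Λ 4 ≃ Finset (Orb Λ)` — the
  configuration `k : Λ → Fin 4` (local basis `|0⟩, |↑⟩, |↓⟩, |↑↓⟩` of `FermionicPEPS.siteOcc`,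
  i.e. `k x = siteConfig s x`) corresponds to the occupied set `s = {(x, σ) : σ ∈ siteOcc (k x)}`;
* `JordanWigner.toSpin : Matrix (Finset (Orb Λ)) (Finset (Orb Λ)) ℂ ≃ₐ[ℂ] Op Λ 4` (reindexing
  along `configEquiv`, a unital `⋆`-algebra isomorphism) and `JordanWigner.toSpinVec` (vectors),
  with `toSpin_mulVec`, `star_toSpinVec_dotProduct`, `expect_eq`, `isNParticle_iff`;
* the one-site `4 × 4` matrices `siteAnnihilation σ`, `siteCreation σ`, `siteNumber σ`,
  `siteParity` (the one-site Fock operators read in the basis `siteOcc`; explicitly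
  `c_↑ = E₀₁ + E₂₃`, `c_↓ = E₀₂ - E₁₃`, `F = diag(1,-1,-1,1)`, `siteAnnihilation_zero_eq` etc.) and
  the Jordan–Wigner STRING `jwString x = ⨂_{y < x} F_y` (`= productOp`, and `= diagonal`);
* THE DICTIONARY (all `Λ` finite linearly ordered):
  `toSpin (annihilation (orb x σ)) = jwString x * onSite x (siteAnnihilation σ)` (`toSpin_annihilation`),
  `toSpin (creation (orb x σ)) = onSite x (siteCreation σ) * jwString x`,
  `toSpin (numberOp x σ) = onSite x (siteNumber σ)`, `toSpin (n_{x↑} n_{x↓}) = onSite x siteDouble`,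
  `toSpin totalNumber = Σ_x onSite x siteTotalNumber`,
  hopping words `toSpin (c†_{xσ} c_{yσ})` with the string strictly between `x` and `y`
  (`toSpin_creation_mul_annihilation_of_lt/_of_gt`, and `_of_covBy` when nothing lies between);
* the Hubbard Hamiltonian of `HubbardWave0.hamiltonian` on ANY graph (`toSpin_hamiltonian`) and, string
  free, on the OPEN CHAIN `SimpleGraph.pathGraph N` (`toSpin_hamiltonian_pathGraph`): a sum of
  nearest-neighbour two-site words `onSite j (c†_σ F) * onSite (j+1) c_σ + onSite j (F c_σ) * onSite (j+1) c†_σ`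
  and on-site terms `U · onSite j (n_↑ n_↓)` — the form consumed by transfer-matrix / matrix-product
  computations (`OpenMPSProductExpectation`, `RingCorrelationsTransfer`).

## The mathematics and its source

Jordan–Wigner (1928) represent fermionic modes on a tensor product of two-level systems,
`c_j = (∏_{i<j} σ^z_i) σ^+_j`. For electrons (two species per site) with the SITE-MAJOR ordering of
the modes, Essler–Frahm–Göhmann–Klümper–Korepin, *The One-Dimensional Hubbard Model* (2005),
§12.3.4 "Fermi operators", eqs. (12.196)–(12.201), give the matrices: in the local basis
`|0⟩, |↑⟩, |↓⟩, |↑↓⟩` (their renumbering `(11),(12),(21),(22) → 1,2,3,4`, grading `p = 0,1,1,0`)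
`c_{j↑} = e_1^2 + e_3^4`, `c_{j↓} = e_1^3 - e_2^4` at site `j`, tensored with the parity
`σ^z ⊗ σ^z = diag(1,-1,-1,1)` on every site on ONE side of `j` and with the identity on the other
side [(12.198)–(12.201)]. These are literally `siteAnnihilation 0`, `siteAnnihilation 1` and
`siteParity` below (`siteAnnihilation_zero_eq`, `siteAnnihilation_one_eq`, `siteParity_eq`).
CONVENTION NOTE: Essler et al. put the string on the sites FOLLOWING `j` (and order `↓` before `↑`
inside the string exponent count), whereas the tree's `jwSign` counts the occupied orbitals BELOW
`(x, σ)`; so here the string `jwString x` runs over the sites `y < x` — the printed formulas with the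
site order reversed. Nothing else differs. The nearest-neighbour form of the chain Hamiltonian
(no string survives between adjacent sites in the site-major order; only the in-site factor `F` at
the left site) is the standard starting point of fermionic MPS/DMRG treatments of the Hubbard chain.

## References

* P. Jordan, E. Wigner, *Über das Paulische Äquivalenzverbot*, Z. Phys. 47 (1928) 631–651.
  [cite: JordanWigner1928]
* F. H. L. Essler, H. Frahm, F. Göhmann, A. Klümper, V. E. Korepin, *The One-Dimensional Hubbard
  Model*, Cambridge University Press (2005), §12.3.4, eqs. (12.196)–(12.201) (read: pp. 426–428).
  [cite: EsslerEtAl2005, §12.3.4 eqs. (12.196)–(12.201)]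

## Tree / Mathlib search

Reused, never redefined: `siteOcc`, `siteIndex`, `siteEquiv`, `siteCharge`, `localOcc`, `siteConfig`,
`card_eq_sum_siteCharge` (`FermionicPEPS`); `Op`, `TensorIndex`, `onSite`, `onSite_apply`,
`onSite_conjTranspose` (`SpinSystem`); `productOp`, `productOp_mul`, `productOp_one`,
`productOp_conjTranspose`, `onSite_eq_productOp`, `onSite_mul`, `onSite_mul_onSite_comm`
(`ProductOperators`); `annihilation`, `creation`, `jwSign`, `orb`, `numberOp`, `totalNumber`,
`hamiltonian`, `IsNParticle`, `expect` (`HubbardWave0`); `annihilation_apply`, `orb_eq_orb_iff`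
(`FermionOperatorsProofs`). Mathlib: `Matrix.reindexAlgEquiv`, `LinearEquiv.funCongrLeft`,
`Prod.Lex.toLex_lt_toLex`, `SimpleGraph.pathGraph_adj`. No Fock-space-to-spin-system identification
existed in the tree (`lean search 'jordanWigner|toSpin|configEquiv'`: only the order-embedding
functoriality `JWEmbed.jwEmbed` of `FermionEmbedding`, a different object).
-/

noncomputable section

namespace Literature.MathematicalPhysics.QuantumLattice

namespace JordanWigner

open Matrix Finset
open scoped ComplexOrder

/-! ### One-site matrices: the Fock operators of a single site in the basis `siteOcc` -/

section Site

/-- The one-site annihilation matrix `c_σ` (`4 × 4`, local basis `|0⟩, |↑⟩, |↓⟩, |↑↓⟩` of `siteOcc`):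
the one-site Jordan–Wigner matrix `annihilation σ` on `Fock (Fin 2)` read in the basis `siteOcc`,
i.e. `(c_σ)_{ab} = [σ ∉ siteOcc a ∧ siteOcc b = insert σ (siteOcc a)] · (-1)^{#{τ ∈ siteOcc a : τ < σ}}`.
Explicitly `c_↑ = e_1^2 + e_3^4`, `c_↓ = e_1^3 - e_2^4` (`siteAnnihilation_zero_eq`, `_one_eq`).
[cite: EsslerEtAl2005, §12.3.4 eqs. (12.197), (12.200)–(12.201)] -/
def siteAnnihilation (σ : Fin 2) : Matrix (Fin 4) (Fin 4) ℂ :=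
  of fun a b => annihilation σ (siteOcc a) (siteOcc b)

/-- The one-site creation matrix `c†_σ = (c_σ)ᴴ`.
[cite: EsslerEtAl2005, §12.3.4 eqs. (12.197)–(12.199)] -/
def siteCreation (σ : Fin 2) : Matrix (Fin 4) (Fin 4) ℂ := (siteAnnihilation σ)ᴴ

/-- The one-site number matrix `n_σ = diag([σ ∈ siteOcc a])` (`n_↑ = diag(0,1,0,1)`,
`n_↓ = diag(0,0,1,1)`). [cite: EsslerEtAl2005, §12.3.4 eq. (12.196)] -/
def siteNumber (σ : Fin 2) : Matrix (Fin 4) (Fin 4) ℂ :=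
  diagonal fun a => if σ ∈ siteOcc a then 1 else 0

/-- The one-site double-occupancy matrix `n_↑ n_↓ = diag(0,0,0,1)`.
[cite: EsslerEtAl2005, §12.3.4 eq. (12.196)] -/
def siteDouble : Matrix (Fin 4) (Fin 4) ℂ :=
  diagonal fun a => if a = 3 then 1 else 0

/-- The one-site electron-number matrix `n_↑ + n_↓ = diag(0,1,1,2) = diag(siteCharge)`.
[cite: EsslerEtAl2005, §12.3.4 eq. (12.196)] -/
def siteTotalNumber : Matrix (Fin 4) (Fin 4) ℂ :=
  diagonal fun a => (siteCharge a : ℂ)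

/-- The one-site fermion parity `F = (-1)^{n_↑ + n_↓} = diag(1,-1,-1,1)` (`σ^z ⊗ σ^z`), the
factor of the Jordan–Wigner string. [cite: EsslerEtAl2005, §12.3.4 eq. (12.198)] -/
def siteParity : Matrix (Fin 4) (Fin 4) ℂ :=
  diagonal fun a => (-1 : ℂ) ^ siteCharge a

/-- Entries of `c_σ` (definitional). [cite: EsslerEtAl2005, §12.3.4 eq. (12.197)] -/
theorem siteAnnihilation_apply (σ : Fin 2) (a b : Fin 4) :
    siteAnnihilation σ a b =
      if σ ∉ siteOcc a ∧ siteOcc b = insert σ (siteOcc a) then jwSign σ (siteOcc a) else 0 := rfl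

/-- `c_σ` is the one-site Fock matrix `annihilation σ` reindexed along `siteEquiv`.
[cite: EsslerEtAl2005, §12.3.4 eq. (12.197)] -/
theorem siteAnnihilation_eq_submatrix (σ : Fin 2) :
    siteAnnihilation σ = (annihilation σ).submatrix siteOcc siteOcc := rfl

/-- `c†_σ` is the one-site Fock matrix `creation σ` reindexed along `siteEquiv`.
[cite: EsslerEtAl2005, §12.3.4 eq. (12.197)] -/
theorem siteCreation_eq_submatrix (σ : Fin 2) :
    siteCreation σ = (creation σ).submatrix siteOcc siteOcc := by
  rw [siteCreation, siteAnnihilation_eq_submatrix, creation, conjTranspose_submatrix]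

/-- `n_σ` is the one-site Fock matrix `numberAt σ` reindexed along `siteEquiv`.
[cite: EsslerEtAl2005, §12.3.4 eq. (12.196)] -/
theorem siteNumber_eq_submatrix (σ : Fin 2) :
    siteNumber σ = (numberAt σ).submatrix siteOcc siteOcc := by
  rw [numberAt_eq_diagonal, siteNumber]
  ext a b
  simp only [diagonal_apply, submatrix_apply, siteEquiv.injective.eq_iff.symm]
  rfl

/-- `c†_σ c_σ = n_σ` on one site. [cite: EsslerEtAl2005, §12.3.4 eq. (12.196)] -/
theorem siteCreation_mul_siteAnnihilation (σ : Fin 2) :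
    siteCreation σ * siteAnnihilation σ = siteNumber σ := by
  rw [siteCreation_eq_submatrix, siteAnnihilation_eq_submatrix, siteNumber_eq_submatrix,
    show (siteOcc : Fin 4 → Finset (Fin 2)) = siteEquiv from rfl, submatrix_mul_equiv]
  rfl

/-- `n_↑ n_↓ = siteDouble`. [cite: EsslerEtAl2005, §12.3.4 eq. (12.196)] -/
theorem siteNumber_zero_mul_siteNumber_one : siteNumber 0 * siteNumber 1 = siteDouble := by
  rw [siteNumber, siteNumber, siteDouble, diagonal_mul_diagonal]
  congr 1
  funext a
  fin_cases a <;> simp [siteOcc]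

/-- `n_↑ + n_↓ = siteTotalNumber`. [cite: EsslerEtAl2005, §12.3.4 eq. (12.196)] -/
theorem siteNumber_zero_add_siteNumber_one : siteNumber 0 + siteNumber 1 = siteTotalNumber := by
  rw [siteNumber, siteNumber, siteTotalNumber, diagonal_add]
  congr 1
  funext a
  fin_cases a <;> norm_num [siteOcc, siteCharge]

/-- `F² = 1`. [cite: EsslerEtAl2005, §12.3.4 eq. (12.198)] -/
theorem siteParity_mul_siteParity : siteParity * siteParity = 1 := by
  rw [siteParity, diagonal_mul_diagonal, ← diagonal_one]
  congr 1
  funext a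
  rw [← pow_add, ← two_mul, pow_mul]
  norm_num

/-- `F` is Hermitian. [cite: EsslerEtAl2005, §12.3.4 eq. (12.198)] -/
theorem siteParity_conjTranspose : siteParityᴴ = siteParity := by
  rw [siteParity, diagonal_conjTranspose]
  congr 1
  funext a
  simp

/-- `c_↑ = e_1^2 + e_3^4`: `c_↑ |↑⟩ = |0⟩`, `c_↑ |↑↓⟩ = |↓⟩` (no sign: `↑` is the lowest orbital of
the site). [cite: EsslerEtAl2005, §12.3.4 eq. (12.200)] -/
theorem siteAnnihilation_zero_eq :
    siteAnnihilation 0 = !![0, 1, 0, 0; 0, 0, 0, 0; 0, 0, 0, 1; 0, 0, 0, 0] := by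
  ext a b
  fin_cases a <;> fin_cases b <;> rfl

/-- `c_↓ = e_1^3 - e_2^4`: `c_↓ |↓⟩ = |0⟩`, `c_↓ |↑↓⟩ = -|↑⟩` (the sign of moving past the occupied
`↑` orbital of the same site). [cite: EsslerEtAl2005, §12.3.4 eq. (12.201)] -/
theorem siteAnnihilation_one_eq :
    siteAnnihilation 1 = !![0, 0, 1, 0; 0, 0, 0, -1; 0, 0, 0, 0; 0, 0, 0, 0] := by
  ext a b
  fin_cases a <;> fin_cases b <;>
    first | rfl | simp (decide := true) [siteAnnihilation_apply, jwSign, Finset.filter_singleton]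

/-- `F = diag(1,-1,-1,1)`. [cite: EsslerEtAl2005, §12.3.4 eq. (12.198)] -/
theorem siteParity_eq : siteParity = !![1, 0, 0, 0; 0, -1, 0, 0; 0, 0, -1, 0; 0, 0, 0, 1] := by
  ext a b
  fin_cases a <;> fin_cases b <;> simp [siteParity, siteCharge, siteOcc]

/-- `n_↑ n_↓ = diag(0,0,0,1)`. [cite: EsslerEtAl2005, §12.3.4 eq. (12.196)] -/
theorem siteDouble_eq : siteDouble = !![0, 0, 0, 0; 0, 0, 0, 0; 0, 0, 0, 0; 0, 0, 0, 1] := by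
  ext a b
  fin_cases a <;> fin_cases b <;> simp [siteDouble]

end Site

/-! ### The configuration bijection `(Λ → Fin 4) ≃ 𝒫(Orb Λ)` -/

section Config

variable {Λ : Type*} [Fintype Λ]

/-- The occupied orbital set `{(x, σ) : σ ∈ siteOcc (k x)}` of a configuration `k : Λ → Fin 4`.
[cite: EsslerEtAl2005, §12.3.4 eq. (12.196)] -/
def config (k : TensorIndex Λ 4) : Finset (Orb Λ) :=
  univ.filter fun o => (ofLex o).2 ∈ siteOcc (k (ofLex o).1)

/-- Membership in `config k`. [cite: EsslerEtAl2005, §12.3.4 eq. (12.196)] -/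
theorem mem_config {k : TensorIndex Λ 4} {o : Orb Λ} :
    o ∈ config k ↔ (ofLex o).2 ∈ siteOcc (k (ofLex o).1) := by
  simp [config]

/-- `(x, σ) ∈ config k ↔ σ ∈ siteOcc (k x)`. [cite: EsslerEtAl2005, §12.3.4 eq. (12.196)] -/
@[simp] theorem orb_mem_config {k : TensorIndex Λ 4} {x : Λ} {σ : Fin 2} :
    orb x σ ∈ config k ↔ σ ∈ siteOcc (k x) := by
  rw [mem_config]
  rfl

variable [LinearOrder Λ]

/-- The local occupation of `config k` at `x` is `siteOcc (k x)`.
[cite: EsslerEtAl2005, §12.3.4 eq. (12.196)] -/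
@[simp] theorem localOcc_config (k : TensorIndex Λ 4) (x : Λ) : localOcc (config k) x = siteOcc (k x) := by
  ext σ
  simp [localOcc]

/-- `siteConfig (config k) = k`. [cite: EsslerEtAl2005, §12.3.4 eq. (12.196)] -/
@[simp] theorem siteConfig_config (k : TensorIndex Λ 4) : siteConfig (config k) = k := by
  funext x
  rw [siteConfig, localOcc_config, siteIndex_siteOcc]

/-- `config (siteConfig s) = s`. [cite: EsslerEtAl2005, §12.3.4 eq. (12.196)] -/
@[simp] theorem config_siteConfig (s : Finset (Orb Λ)) : config (siteConfig s) = s := by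
  ext o
  rw [mem_config, siteOcc_siteConfig, localOcc, mem_filter]
  simp only [mem_univ, true_and]
  rw [show orb (ofLex o).1 (ofLex o).2 = o from rfl]

/-- The Jordan–Wigner configuration bijection `(Λ → Fin 4) ≃ 𝒫(Orb Λ)`.
[cite: EsslerEtAl2005, §12.3.4 eq. (12.196)] -/
def configEquiv : TensorIndex Λ 4 ≃ Finset (Orb Λ) :=
  ⟨config, siteConfig, siteConfig_config, config_siteConfig⟩

/-- `configEquiv` is `config`. [cite: EsslerEtAl2005, §12.3.4 eq. (12.196)] -/
@[simp] theorem configEquiv_apply (k : TensorIndex Λ 4) : configEquiv k = config k := rfl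

/-- The inverse of `configEquiv` is `siteConfig`. [cite: EsslerEtAl2005, §12.3.4 eq. (12.196)] -/
@[simp] theorem configEquiv_symm_apply (s : Finset (Orb Λ)) : configEquiv.symm s = siteConfig s := rfl

/-- Two configurations have the same occupied set off the site `x` iff they agree off `x`, and
`config k' = insert (x,σ) (config k)` says exactly: `k'` agrees with `k` off `x` and
`siteOcc (k' x) = insert σ (siteOcc (k x))`. [cite: EsslerEtAl2005, §12.3.4 eq. (12.196)] -/
theorem config_eq_insert_iff (k k' : TensorIndex Λ 4) (x : Λ) (σ : Fin 2) :
    config k' = insert (orb x σ) (config k) ↔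
      (∀ y, y ≠ x → k' y = k y) ∧ siteOcc (k' x) = insert σ (siteOcc (k x)) := by
  constructor
  · intro h
    have hmem : ∀ y τ, τ ∈ siteOcc (k' y) ↔ (y = x ∧ τ = σ) ∨ τ ∈ siteOcc (k y) := by
      intro y τ
      rw [← orb_mem_config, h, mem_insert, orb_eq_orb_iff, orb_mem_config]
    refine ⟨fun y hy => ?_, ?_⟩
    · apply siteEquiv.injective
      ext τ
      rw [show siteEquiv (k' y) = siteOcc (k' y) from rfl, show siteEquiv (k y) = siteOcc (k y) from rfl,
        hmem]
      simp [hy]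
    · ext τ
      rw [hmem, mem_insert]
      simp
  · rintro ⟨hoff, hx⟩
    ext o
    rw [mem_insert, mem_config, mem_config]
    rcases eq_or_ne (ofLex o).1 x with h1 | h1
    · rw [h1, hx, mem_insert]
      have ho : o = orb x (ofLex o).2 := by rw [← h1]; rfl
      constructor
      · rintro (h2 | h2)
        · left; rw [ho, h2]
        · right; exact h2
      · rintro (h2 | h2)
        · left
          have := congrArg (fun o' => (ofLex o').2) h2
          simpa using this
        · right; exact h2
    · rw [hoff _ h1]
      constructor
      · intro h2; right; exact h2
      · rintro (h2 | h2)
        · exact absurd (by rw [h2]; rfl) h1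
        · exact h2

/-- The number of occupied orbitals of `config k` below `(x, σ)` in the site-major order:
all electrons on the sites `y < x`, plus those of site `x` with spin below `σ`.
[cite: EsslerEtAl2005, §12.3.4 eqs. (12.198)–(12.201)] -/
theorem card_config_filter_lt (k : TensorIndex Λ 4) (x : Λ) (σ : Fin 2) :
    ((config k).filter (· < orb x σ)).card =
      (∑ y ∈ univ.filter (· < x), siteCharge (k y)) + ((siteOcc (k x)).filter (· < σ)).card := by
  classical
  -- split according to the site of the orbital
  have hsplit : (config k).filter (· < orb x σ) =
      ((config k).filter fun o => (ofLex o).1 < x) ∪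
        ((config k).filter fun o => (ofLex o).1 = x ∧ (ofLex o).2 < σ) := by
    ext o
    simp only [mem_filter, mem_union]
    have : o < orb x σ ↔ (ofLex o).1 < x ∨ (ofLex o).1 = x ∧ (ofLex o).2 < σ := by
      rw [show o = toLex (ofLex o) from rfl, orb, Prod.Lex.toLex_lt_toLex]
      rfl
    rw [this]
    tauto
  have hdisj : Disjoint ((config k).filter fun o => (ofLex o).1 < x)
      ((config k).filter fun o => (ofLex o).1 = x ∧ (ofLex o).2 < σ) := by
    rw [Finset.disjoint_filter]
    rintro o _ h1 ⟨h2, _⟩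
    exact absurd h2 (ne_of_lt h1)
  rw [hsplit, card_union_of_disjoint hdisj]
  congr 1
  · -- electrons on the sites below `x`, counted site by site
    rw [card_eq_sum_card_fiberwise (f := fun o : Orb Λ => (ofLex o).1) (t := univ.filter (· < x))
      (fun o ho => by simpa using (mem_filter.mp ho).2)]
    refine sum_congr rfl fun y hy => ?_
    have hyx : y < x := (mem_filter.mp hy).2
    have hmap : ((config k).filter fun o : Orb Λ => (ofLex o).1 < x).filter
        (fun o : Orb Λ => (ofLex o).1 = y) =
        (siteOcc (k y)).map ⟨fun τ => orb y τ, fun τ τ' h => (orb_eq_orb_iff.mp h).2⟩ := by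
      ext o
      simp only [mem_filter, mem_map, Function.Embedding.coeFn_mk, mem_config]
      constructor
      · rintro ⟨⟨ho, _⟩, hy'⟩
        refine ⟨(ofLex o).2, by rw [← hy']; exact ho, ?_⟩
        rw [← hy']; rfl
      · rintro ⟨τ, hτ, rfl⟩
        exact ⟨⟨hτ, hyx⟩, rfl⟩
    rw [hmap, card_map, siteCharge]
  · -- electrons of site `x` with spin below `σ`
    have hmap : ((config k).filter fun o : Orb Λ => (ofLex o).1 = x ∧ (ofLex o).2 < σ) =
        ((siteOcc (k x)).filter (· < σ)).map
          ⟨fun τ => orb x τ, fun τ τ' h => (orb_eq_orb_iff.mp h).2⟩ := by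
      ext o
      simp only [mem_filter, mem_map, Function.Embedding.coeFn_mk, mem_config]
      constructor
      · rintro ⟨ho, hx', hlt⟩
        refine ⟨(ofLex o).2, ⟨by rw [← hx']; exact ho, hlt⟩, ?_⟩
        rw [← hx']; rfl
      · rintro ⟨τ, ⟨hτ, hlt⟩, rfl⟩
        exact ⟨hτ, rfl, hlt⟩
    rw [hmap, card_map]

/-- The Jordan–Wigner sign of the orbital `(x, σ)` in `config k` factorises into the string over
the sites below `x` and the in-site sign. [cite: EsslerEtAl2005, §12.3.4 eqs. (12.198)–(12.201)] -/
theorem jwSign_orb_config (k : TensorIndex Λ 4) (x : Λ) (σ : Fin 2) :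
    jwSign (orb x σ) (config k) =
      (∏ y ∈ univ.filter (· < x), (-1 : ℂ) ^ siteCharge (k y)) * jwSign σ (siteOcc (k x)) := by
  rw [jwSign, card_config_filter_lt, pow_add, prod_pow_eq_pow_sum, jwSign]

/-- Every configuration has `#(config k) = Σ_x siteCharge (k x)` electrons.
[cite: EsslerEtAl2005, §12.3.4 eq. (12.196)] -/
theorem card_config (k : TensorIndex Λ 4) : (config k).card = ∑ x, siteCharge (k x) := by
  rw [card_eq_sum_siteCharge]
  simp

end Config

/-! ### Transport of operators and vectors -/

section Transport

variable {Λ : Type*} [LinearOrder Λ] [Fintype Λ]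

/-- **The Jordan–Wigner isomorphism on operators**: a Fock-space matrix read in the product basis
`|k⟩ = |config k⟩`, `(toSpin A)_{k k'} = A_{config k, config k'}`; a unital `⋆`-algebra isomorphism
`Matrix (𝒫(Orb Λ)) ≃ₐ Op Λ 4` (Mathlib's `Matrix.reindexAlgEquiv` along `configEquiv`).
[cite: EsslerEtAl2005, §12.3.4 eqs. (12.196)–(12.201)] -/
def toSpin : Matrix (Finset (Orb Λ)) (Finset (Orb Λ)) ℂ ≃ₐ[ℂ] Op Λ 4 :=
  Matrix.reindexAlgEquiv ℂ ℂ (configEquiv (Λ := Λ)).symm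

/-- Entries of `toSpin A`. [cite: EsslerEtAl2005, §12.3.4 eq. (12.196)] -/
@[simp] theorem toSpin_apply (A : Matrix (Finset (Orb Λ)) (Finset (Orb Λ)) ℂ) (k k' : TensorIndex Λ 4) :
    toSpin A k k' = A (config k) (config k') := by
  simp [toSpin]

/-- `toSpin` is a `⋆`-map. [cite: EsslerEtAl2005, §12.3.4 eq. (12.197)] -/
theorem toSpin_conjTranspose (A : Matrix (Finset (Orb Λ)) (Finset (Orb Λ)) ℂ) :
    toSpin Aᴴ = (toSpin A)ᴴ := by
  ext k k'
  simp

/-- **The Jordan–Wigner isomorphism on vectors**: `(toSpinVec ψ) k = ψ (config k)`.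
[cite: EsslerEtAl2005, §12.3.4 eq. (12.196)] -/
def toSpinVec : Fock (Orb Λ) ≃ₗ[ℂ] (TensorIndex Λ 4 → ℂ) :=
  LinearEquiv.funCongrLeft ℂ ℂ (configEquiv (Λ := Λ))

/-- Components of `toSpinVec ψ`. [cite: EsslerEtAl2005, §12.3.4 eq. (12.196)] -/
@[simp] theorem toSpinVec_apply (ψ : Fock (Orb Λ)) (k : TensorIndex Λ 4) :
    toSpinVec ψ k = ψ (config k) := rfl

/-- Components of the inverse `toSpinVec.symm φ`. [cite: EsslerEtAl2005, §12.3.4 eq. (12.196)] -/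
@[simp] theorem toSpinVec_symm_apply (φ : TensorIndex Λ 4 → ℂ) (s : Finset (Orb Λ)) :
    toSpinVec.symm φ s = φ (siteConfig s) := rfl

/-- `toSpin` intertwines the actions on vectors. [cite: EsslerEtAl2005, §12.3.4 eq. (12.196)] -/
theorem toSpin_mulVec (A : Matrix (Finset (Orb Λ)) (Finset (Orb Λ)) ℂ) (ψ : Fock (Orb Λ)) :
    toSpin A *ᵥ toSpinVec ψ = toSpinVec (A *ᵥ ψ) := by
  ext k
  simp only [mulVec, dotProduct, toSpin_apply, toSpinVec_apply]
  exact Fintype.sum_equiv configEquiv _ _ fun k' => rfl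

/-- `toSpinVec` preserves the inner product. [cite: EsslerEtAl2005, §12.3.4 eq. (12.196)] -/
theorem star_toSpinVec_dotProduct (ψ φ : Fock (Orb Λ)) :
    star (toSpinVec ψ) ⬝ᵥ toSpinVec φ = star ψ ⬝ᵥ φ := by
  simp only [dotProduct, Pi.star_apply, toSpinVec_apply]
  exact Fintype.sum_equiv configEquiv _ _ fun k' => rfl

/-- Expectation values are computed equally on either side. [cite: EsslerEtAl2005, §12.3.4 eq. (12.196)] -/
theorem expect_eq (A : Matrix (Finset (Orb Λ)) (Finset (Orb Λ)) ℂ) (ψ : Fock (Orb Λ)) :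
    expect A ψ = star (toSpinVec ψ) ⬝ᵥ (toSpin A *ᵥ toSpinVec ψ) := by
  rw [toSpin_mulVec, star_toSpinVec_dotProduct, expect]

/-- The `N`-particle sector corresponds to the configurations of total charge `N`.
[cite: EsslerEtAl2005, §12.3.4 eq. (12.196)] -/
theorem isNParticle_iff (N : ℕ) (ψ : Fock (Orb Λ)) :
    IsNParticle N ψ ↔ ∀ k : TensorIndex Λ 4, (∑ x, siteCharge (k x)) ≠ N → toSpinVec ψ k = 0 := by
  constructor
  · intro h k hk
    exact h (config k) (by rwa [card_config])
  · intro h s hs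
    have := h (siteConfig s) (by rwa [← card_config, config_siteConfig])
    simpa using this

end Transport

/-! ### The Jordan–Wigner string -/

section JWString

variable {Λ : Type*} [LinearOrder Λ] [Fintype Λ]

/-- The Jordan–Wigner string of the site `x`: the product operator with the parity `F` on every site
`y < x` and the identity elsewhere, `⨂_{y<x} F_y`.
[cite: EsslerEtAl2005, §12.3.4 eqs. (12.198)–(12.201)] -/
def jwString (x : Λ) : Op Λ 4 :=
  productOp fun y => if y < x then siteParity else 1

omit [LinearOrder Λ] in
/-- A product of diagonal one-site matrices is diagonal. [folklore]
[cite: EsslerEtAl2005, §12.3.4 eq. (12.198)] -/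
theorem productOp_diagonal {q : ℕ} (d : Λ → Fin q → ℂ) :
    productOp (fun y => diagonal (d y)) = diagonal fun k : TensorIndex Λ q => ∏ y, d y (k y) := by
  ext k k'
  rw [productOp_apply, diagonal_apply]
  by_cases h : k = k'
  · subst h
    simp
  · rw [if_neg h]
    obtain ⟨y, hy⟩ : ∃ y, k y ≠ k' y := by
      by_contra hc
      push Not at hc
      exact h (funext hc)
    exact prod_eq_zero (mem_univ y) (by simp [hy])

/-- The string is diagonal: `jwString x |k⟩ = (∏_{y<x} (-1)^{siteCharge (k y)}) |k⟩`.
[cite: EsslerEtAl2005, §12.3.4 eq. (12.198)] -/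
theorem jwString_eq_diagonal (x : Λ) :
    jwString x = diagonal fun k : TensorIndex Λ 4 =>
      ∏ y ∈ univ.filter (· < x), (-1 : ℂ) ^ siteCharge (k y) := by
  have h1 : (fun y : Λ => if y < x then siteParity else (1 : Matrix (Fin 4) (Fin 4) ℂ)) =
      fun y => diagonal fun a => if y < x then (-1 : ℂ) ^ siteCharge a else 1 := by
    funext y
    split_ifs
    · rfl
    · exact diagonal_one.symm
  rw [jwString, h1, productOp_diagonal]
  congr 1
  funext k
  rw [prod_filter]

/-- `F_string² = 1`. [cite: EsslerEtAl2005, §12.3.4 eq. (12.198)] -/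
theorem jwString_mul_jwString (x : Λ) : jwString x * jwString x = 1 := by
  rw [jwString, productOp_mul, ← productOp_one]
  congr 1
  funext y
  split_ifs
  · exact siteParity_mul_siteParity
  · exact mul_one 1

/-- The string is Hermitian. [cite: EsslerEtAl2005, §12.3.4 eq. (12.198)] -/
theorem jwString_conjTranspose (x : Λ) : (jwString x)ᴴ = jwString x := by
  rw [jwString, productOp_conjTranspose]
  congr 1
  funext y
  split_ifs
  · exact siteParity_conjTranspose
  · exact conjTranspose_one

/-- The string of `x` commutes with every one-site operator at `x` (disjoint supports).
[cite: EsslerEtAl2005, §12.3.4 eq. (12.198)] -/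
theorem jwString_mul_onSite (x : Λ) (a : Matrix (Fin 4) (Fin 4) ℂ) :
    jwString x * onSite x a = onSite x a * jwString x := by
  rw [jwString, onSite_eq_productOp, productOp_mul, productOp_mul]
  congr 1
  funext y
  by_cases hy : y = x
  · subst hy
    simp
  · rw [Function.update_of_ne hy]
    simp

/-- Strings at two sites `x < y` multiply to the parity of the sites in `[x, y)`.
[cite: EsslerEtAl2005, §12.3.4 eqs. (12.198)–(12.201)] -/
theorem jwString_mul_jwString_of_le {x y : Λ} (hxy : x ≤ y) :
    jwString x * jwString y = productOp fun z => if x ≤ z ∧ z < y then siteParity else 1 := by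
  rw [jwString, jwString, productOp_mul]
  congr 1
  funext z
  by_cases h1 : z < x
  · have h2 : z < y := lt_of_lt_of_le h1 hxy
    rw [if_pos h1, if_pos h2, if_neg (fun h => absurd h.1 (not_le.mpr h1)), siteParity_mul_siteParity]
  · by_cases h2 : z < y
    · rw [if_neg h1, if_pos h2, if_pos ⟨not_lt.mp h1, h2⟩, one_mul]
    · rw [if_neg h1, if_neg h2, if_neg (fun h => h2 h.2), mul_one]

/-- Strings commute. [cite: EsslerEtAl2005, §12.3.4 eq. (12.198)] -/
theorem jwString_comm (x y : Λ) : jwString x * jwString y = jwString y * jwString x := by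
  rw [jwString_eq_diagonal, jwString_eq_diagonal, diagonal_mul_diagonal, diagonal_mul_diagonal]
  congr 1
  funext k
  rw [mul_comm]

/-- When no site lies strictly between `x < y` (e.g. neighbours on a chain), the two strings
multiply to the single parity factor at `x`. [cite: EsslerEtAl2005, §12.3.4 eqs. (12.198)–(12.201)] -/
theorem jwString_mul_jwString_of_covBy {x y : Λ} (hxy : x < y) (hcov : ∀ z, x < z → ¬ z < y) :
    jwString x * jwString y = onSite x siteParity := by
  rw [jwString_mul_jwString_of_le hxy.le, onSite_eq_productOp]
  congr 1
  funext z
  by_cases hz : z = x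
  · subst hz
    rw [if_pos ⟨le_rfl, hxy⟩, Function.update_self]
  · rw [Function.update_of_ne hz]
    rw [if_neg]
    rintro ⟨h1, h2⟩
    exact hcov z (lt_of_le_of_ne h1 (Ne.symm hz)) h2

end JWString

/-! ### The dictionary: annihilation, creation, number operators -/

section Dictionary

variable {Λ : Type*} [LinearOrder Λ] [Fintype Λ]

/-- **Jordan–Wigner, site-major**: `c_{xσ} ↦ (⨂_{y<x} F_y) ⊗ (c_σ)_x`.
[cite: EsslerEtAl2005, §12.3.4 eqs. (12.200)–(12.201)] [cite: JordanWigner1928] -/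
theorem toSpin_annihilation (x : Λ) (σ : Fin 2) :
    toSpin (annihilation (orb x σ)) = jwString x * onSite x (siteAnnihilation σ) := by
  ext k k'
  rw [toSpin_apply, annihilation_apply, jwString_eq_diagonal, diagonal_mul, onSite_apply,
    siteAnnihilation_apply]
  by_cases hoff : ∀ y, y ≠ x → k y = k' y
  · rw [if_pos hoff]
    by_cases hloc : σ ∉ siteOcc (k x) ∧ siteOcc (k' x) = insert σ (siteOcc (k x))
    · have h : orb x σ ∉ config k ∧ config k' = insert (orb x σ) (config k) :=
        ⟨by rw [orb_mem_config]; exact hloc.1, (config_eq_insert_iff k k' x σ).mpr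
          ⟨fun y hy => (hoff y hy).symm, hloc.2⟩⟩
      rw [if_pos h, if_pos hloc, jwSign_orb_config]
    · have h : ¬ (orb x σ ∉ config k ∧ config k' = insert (orb x σ) (config k)) := fun h =>
        hloc ⟨by have h1 := h.1; rwa [orb_mem_config] at h1,
          ((config_eq_insert_iff k k' x σ).mp h.2).2⟩
      rw [if_neg h, if_neg hloc, mul_zero]
  · have h : ¬ (orb x σ ∉ config k ∧ config k' = insert (orb x σ) (config k)) := fun h =>
      hoff fun y hy => (((config_eq_insert_iff k k' x σ).mp h.2).1 y hy).symm
    rw [if_neg h, if_neg hoff, mul_zero]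

/-- `c†_{xσ} ↦ (c†_σ)_x ⊗ (⨂_{y<x} F_y)`. [cite: EsslerEtAl2005, §12.3.4 eqs. (12.198)–(12.199)] -/
theorem toSpin_creation (x : Λ) (σ : Fin 2) :
    toSpin (creation (orb x σ)) = onSite x (siteCreation σ) * jwString x := by
  rw [creation, toSpin_conjTranspose, toSpin_annihilation, conjTranspose_mul, jwString_conjTranspose,
    ← onSite_conjTranspose, siteCreation]

/-- `n_{xσ} ↦ (n_σ)_x` (the strings cancel). [cite: EsslerEtAl2005, §12.3.4 eq. (12.196)] -/
theorem toSpin_numberOp (x : Λ) (σ : Fin 2) :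
    toSpin (numberOp x σ) = onSite x (siteNumber σ) := by
  rw [numberOp, map_mul, toSpin_creation, toSpin_annihilation, Matrix.mul_assoc,
    ← Matrix.mul_assoc (jwString x), jwString_mul_jwString, Matrix.one_mul, onSite_mul,
    siteCreation_mul_siteAnnihilation]

/-- `n_{x↑} n_{x↓} ↦ (n_↑ n_↓)_x`. [cite: EsslerEtAl2005, §12.3.4 eq. (12.196)] -/
theorem toSpin_numberOp_mul_numberOp (x : Λ) :
    toSpin (numberOp x 0 * numberOp x 1) = onSite x siteDouble := by
  rw [map_mul, toSpin_numberOp, toSpin_numberOp, onSite_mul, siteNumber_zero_mul_siteNumber_one]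

/-- `N̂ ↦ Σ_x (n_↑ + n_↓)_x`. [cite: EsslerEtAl2005, §12.3.4 eq. (12.196)] -/
theorem toSpin_totalNumber :
    toSpin (totalNumber (Λ := Λ)) = ∑ x : Λ, onSite x siteTotalNumber := by
  rw [totalNumber, map_sum]
  refine sum_congr rfl fun x _ => ?_
  rw [map_sum, Fin.sum_univ_two, toSpin_numberOp, toSpin_numberOp, ← onSite_add',
    siteNumber_zero_add_siteNumber_one]

/-- A hopping word in general position: `c†_{xσ} c_{yτ} ↦ (c†_σ)_x F_{string x} F_{string y} (c_τ)_y`.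
[cite: EsslerEtAl2005, §12.3.4 eqs. (12.198)–(12.201)] -/
theorem toSpin_creation_mul_annihilation (x y : Λ) (σ τ : Fin 2) :
    toSpin (creation (orb x σ) * annihilation (orb y τ)) =
      onSite x (siteCreation σ) * (jwString x * jwString y) * onSite y (siteAnnihilation τ) := by
  rw [map_mul, toSpin_creation, toSpin_annihilation]
  simp only [Matrix.mul_assoc]

/-- Hopping to the right, `x < y`: the string survives on the sites `z` with `x ≤ z < y`.
[cite: EsslerEtAl2005, §12.3.4 eqs. (12.198)–(12.201)] -/
theorem toSpin_creation_mul_annihilation_of_lt {x y : Λ} (hxy : x < y) (σ τ : Fin 2) :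
    toSpin (creation (orb x σ) * annihilation (orb y τ)) =
      onSite x (siteCreation σ) * productOp (fun z => if x ≤ z ∧ z < y then siteParity else 1) *
        onSite y (siteAnnihilation τ) := by
  rw [toSpin_creation_mul_annihilation, jwString_mul_jwString_of_le hxy.le]

/-- Hopping to the left, `y < x`: the string survives on the sites `z` with `y ≤ z < x`.
[cite: EsslerEtAl2005, §12.3.4 eqs. (12.198)–(12.201)] -/
theorem toSpin_creation_mul_annihilation_of_gt {x y : Λ} (hyx : y < x) (σ τ : Fin 2) :
    toSpin (creation (orb x σ) * annihilation (orb y τ)) =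
      onSite x (siteCreation σ) * productOp (fun z => if y ≤ z ∧ z < x then siteParity else 1) *
        onSite y (siteAnnihilation τ) := by
  rw [toSpin_creation_mul_annihilation, jwString_comm, jwString_mul_jwString_of_le hyx.le]

/-- **Nearest neighbours, hopping to the right** (`x < y`, nothing in between):
`c†_{xσ} c_{yτ} ↦ (c†_σ F)_x (c_τ)_y` — a two-site word, no string.
[cite: EsslerEtAl2005, §12.3.4 eqs. (12.198)–(12.201)] -/
theorem toSpin_creation_mul_annihilation_of_covBy {x y : Λ} (hxy : x < y)
    (hcov : ∀ z, x < z → ¬ z < y) (σ τ : Fin 2) :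
    toSpin (creation (orb x σ) * annihilation (orb y τ)) =
      onSite x (siteCreation σ * siteParity) * onSite y (siteAnnihilation τ) := by
  rw [toSpin_creation_mul_annihilation, jwString_mul_jwString_of_covBy hxy hcov, onSite_mul]

/-- **Nearest neighbours, hopping to the left** (`y < x`, nothing in between):
`c†_{xσ} c_{yτ} ↦ (F c_τ)_y (c†_σ)_x`. [cite: EsslerEtAl2005, §12.3.4 eqs. (12.198)–(12.201)] -/
theorem toSpin_creation_mul_annihilation_of_covBy' {x y : Λ} (hyx : y < x)
    (hcov : ∀ z, y < z → ¬ z < x) (σ τ : Fin 2) :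
    toSpin (creation (orb x σ) * annihilation (orb y τ)) =
      onSite y (siteParity * siteAnnihilation τ) * onSite x (siteCreation σ) := by
  rw [toSpin_creation_mul_annihilation, jwString_comm, jwString_mul_jwString_of_covBy hyx hcov,
    Matrix.mul_assoc, onSite_mul, onSite_mul_onSite_comm (ne_of_gt hyx)]

end Dictionary

/-! ### The Hubbard Hamiltonian in spin language -/

section Hamiltonian

variable {Λ : Type*} [LinearOrder Λ] [Fintype Λ]

/-- **The Hubbard Hamiltonian on any finite graph, in the product basis**: hopping words with their
Jordan–Wigner strings and on-site `U n_↑ n_↓` terms (the image of `HubbardWave0.hamiltonian`, term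
by term). [cite: EsslerEtAl2005, §12.3.4 eqs. (12.196)–(12.201)] [cite: JordanWigner1928] -/
theorem toSpin_hamiltonian (G : SimpleGraph Λ) [DecidableRel G.Adj] (t U : ℝ) :
    toSpin (hamiltonian G t U) =
      -(t : ℂ) • (∑ x : Λ, ∑ y : Λ, ∑ σ : Fin 2, if G.Adj x y then
          onSite x (siteCreation σ) * (jwString x * jwString y) * onSite y (siteAnnihilation σ)
        else 0) +
      (U : ℂ) • ∑ x : Λ, onSite x siteDouble := by
  rw [hamiltonian, map_add, map_smul, map_smul, map_sum, map_sum]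
  congr 2
  · refine sum_congr rfl fun x _ => ?_
    rw [map_sum]
    refine sum_congr rfl fun y _ => ?_
    rw [map_sum]
    refine sum_congr rfl fun σ _ => ?_
    split_ifs
    · exact toSpin_creation_mul_annihilation x y σ σ
    · exact map_zero _
  · exact sum_congr rfl fun x _ => toSpin_numberOp_mul_numberOp x

/-- Bookkeeping on the open chain `Fin N`: a sum over ordered adjacent pairs of the path graph is a
sum over the bonds `(i, i+1)` of both orientations. [folklore]
[cite: EsslerEtAl2005, §12.3.4 eq. (12.196)] -/
theorem sum_sum_ite_pathGraph_adj {M : Type*} [AddCommMonoid M] (N : ℕ)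
    [DecidableRel (SimpleGraph.pathGraph N).Adj] (f : Fin N → Fin N → M) :
    (∑ x : Fin N, ∑ y : Fin N, if (SimpleGraph.pathGraph N).Adj x y then f x y else 0) =
      ∑ i : Fin N, ∑ j : Fin N, if i.val + 1 = j.val then f i j + f j i else 0 := by
  have h : ∀ x y : Fin N, (if (SimpleGraph.pathGraph N).Adj x y then f x y else 0) =
      (if x.val + 1 = y.val then f x y else 0) + (if y.val + 1 = x.val then f x y else 0) := by
    intro x y
    by_cases h1 : x.val + 1 = y.val
    · have hadj : (SimpleGraph.pathGraph N).Adj x y := SimpleGraph.pathGraph_adj.mpr (Or.inl h1)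
      have h2 : ¬ (y.val + 1 = x.val) := by omega
      rw [if_pos hadj, if_pos h1, if_neg h2, add_zero]
    · by_cases h2 : y.val + 1 = x.val
      · have hadj : (SimpleGraph.pathGraph N).Adj x y := SimpleGraph.pathGraph_adj.mpr (Or.inr h2)
        rw [if_pos hadj, if_neg h1, if_pos h2, zero_add]
      · have hadj : ¬ (SimpleGraph.pathGraph N).Adj x y := fun h =>
          (SimpleGraph.pathGraph_adj.mp h).elim h1 h2
        rw [if_neg hadj, if_neg h1, if_neg h2, add_zero]
  calc (∑ x : Fin N, ∑ y : Fin N, if (SimpleGraph.pathGraph N).Adj x y then f x y else 0)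
      = ∑ x : Fin N, ∑ y : Fin N,
          ((if x.val + 1 = y.val then f x y else 0) + (if y.val + 1 = x.val then f x y else 0)) :=
        sum_congr rfl fun x _ => sum_congr rfl fun y _ => h x y
    _ = (∑ x : Fin N, ∑ y : Fin N, if x.val + 1 = y.val then f x y else 0) +
          ∑ x : Fin N, ∑ y : Fin N, (if y.val + 1 = x.val then f x y else 0) := by
        simp only [sum_add_distrib]
    _ = (∑ x : Fin N, ∑ y : Fin N, if x.val + 1 = y.val then f x y else 0) +
          ∑ y : Fin N, ∑ x : Fin N, (if y.val + 1 = x.val then f x y else 0) := by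
        congr 1
        exact sum_comm
    _ = ∑ i : Fin N, ∑ j : Fin N, if i.val + 1 = j.val then f i j + f j i else 0 := by
        rw [← sum_add_distrib]
        refine sum_congr rfl fun i _ => ?_
        rw [← sum_add_distrib]
        refine sum_congr rfl fun j _ => ?_
        split_ifs <;> simp

/-- **The Hubbard chain with open boundary conditions is a nearest-neighbour chain of local
dimension `4`**: under the site-major Jordan–Wigner identification,
`H_N ↦ -t Σ_{i+1=j} Σ_σ ((c†_σ F)_i (c_σ)_j + (F c_σ)_i (c†_σ)_j) + U Σ_i (n_↑ n_↓)_i` — two-site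
words between neighbours only, no string. [cite: EsslerEtAl2005, §12.3.4 eqs. (12.196)–(12.201)]
[cite: JordanWigner1928] -/
theorem toSpin_hamiltonian_pathGraph (N : ℕ) [DecidableRel (SimpleGraph.pathGraph N).Adj] (t U : ℝ) :
    toSpin (hamiltonian (SimpleGraph.pathGraph N) t U) =
      -(t : ℂ) • (∑ i : Fin N, ∑ j : Fin N, if i.val + 1 = j.val then
          ∑ σ : Fin 2, (onSite i (siteCreation σ * siteParity) * onSite j (siteAnnihilation σ) +
            onSite i (siteParity * siteAnnihilation σ) * onSite j (siteCreation σ))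
        else 0) +
      (U : ℂ) • ∑ i : Fin N, onSite i siteDouble := by
  rw [toSpin_hamiltonian]
  congr 2
  have hin : ∀ x y : Fin N,
      (∑ σ : Fin 2, if (SimpleGraph.pathGraph N).Adj x y then
          onSite x (siteCreation σ) * (jwString x * jwString y) * onSite y (siteAnnihilation σ)
        else (0 : Op (Fin N) 4)) =
      if (SimpleGraph.pathGraph N).Adj x y then
        ∑ σ : Fin 2, onSite x (siteCreation σ) * (jwString x * jwString y) *
          onSite y (siteAnnihilation σ) else 0 := by
    intro x y
    split_ifs <;> simp
  simp_rw [hin]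
  rw [sum_sum_ite_pathGraph_adj]
  refine sum_congr rfl fun i _ => sum_congr rfl fun j _ => ?_
  by_cases hij : i.val + 1 = j.val
  · rw [if_pos hij, if_pos hij, ← sum_add_distrib]
    have hlt : i < j := Fin.lt_def.mpr (by omega)
    have hcov : ∀ z : Fin N, i < z → ¬ z < j := fun z hz hzj => by
      have h1 := Fin.lt_def.mp hz
      have h2 := Fin.lt_def.mp hzj
      omega
    refine sum_congr rfl fun σ _ => ?_
    rw [← toSpin_creation_mul_annihilation, ← toSpin_creation_mul_annihilation,
      toSpin_creation_mul_annihilation_of_covBy hlt hcov,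
      toSpin_creation_mul_annihilation_of_covBy' hlt hcov]
  · rw [if_neg hij, if_neg hij]

/-- The same with every two-site word written as ONE product operator `⨂_k G_k` (factors `1` away
from the bond; `Function.update (Function.update 1 j b) i a` is `a` at `i`, `b` at `j`), the form
consumed by transfer-matrix computations.
[cite: EsslerEtAl2005, §12.3.4 eqs. (12.196)–(12.201)] -/
theorem toSpin_hamiltonian_pathGraph_productOp (N : ℕ) [DecidableRel (SimpleGraph.pathGraph N).Adj]
    (t U : ℝ) :
    toSpin (hamiltonian (SimpleGraph.pathGraph N) t U) =
      -(t : ℂ) • (∑ i : Fin N, ∑ j : Fin N, if i.val + 1 = j.val then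
          ∑ σ : Fin 2,
            (productOp (Function.update (Function.update (fun _ => (1 : Matrix (Fin 4) (Fin 4) ℂ))
                j (siteAnnihilation σ)) i (siteCreation σ * siteParity)) +
              productOp (Function.update (Function.update (fun _ => (1 : Matrix (Fin 4) (Fin 4) ℂ))
                j (siteCreation σ)) i (siteParity * siteAnnihilation σ)))
        else 0) +
      (U : ℂ) • ∑ i : Fin N, productOp (Function.update (fun _ => (1 : Matrix (Fin 4) (Fin 4) ℂ))
        i siteDouble) := by
  rw [toSpin_hamiltonian_pathGraph]
  congr 2
  · refine sum_congr rfl fun i _ => sum_congr rfl fun j _ => ?_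
    by_cases hij : i.val + 1 = j.val
    · have hne : i ≠ j := fun h => by rw [h] at hij; omega
      rw [if_pos hij, if_pos hij]
      refine sum_congr rfl fun σ _ => ?_
      rw [onSite_mul_onSite_eq_productOp hne, onSite_mul_onSite_eq_productOp hne]
    · rw [if_neg hij, if_neg hij]
  · exact sum_congr rfl fun i _ => onSite_eq_productOp i _

/-- The two-site instance: on `Fin 2` the open-chain Hubbard Hamiltonian is the single bond word
`-t Σ_σ ((c†_σ F)_0 (c_σ)_1 + (F c_σ)_0 (c†_σ)_1) + U ((n_↑n_↓)_0 + (n_↑n_↓)_1)`.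
[cite: EsslerEtAl2005, §12.3.4 eqs. (12.196)–(12.201)] -/
theorem toSpin_hamiltonian_pathGraph_two [DecidableRel (SimpleGraph.pathGraph 2).Adj] (t U : ℝ) :
    toSpin (hamiltonian (SimpleGraph.pathGraph 2) t U) =
      -(t : ℂ) • (∑ σ : Fin 2, (onSite (0 : Fin 2) (siteCreation σ * siteParity) *
            onSite (1 : Fin 2) (siteAnnihilation σ) +
          onSite (0 : Fin 2) (siteParity * siteAnnihilation σ) * onSite (1 : Fin 2) (siteCreation σ))) +
      (U : ℂ) • (onSite (0 : Fin 2) siteDouble + onSite (1 : Fin 2) siteDouble) := by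
  rw [toSpin_hamiltonian_pathGraph]
  congr 2
  · simp [Fin.sum_univ_two]
  · simp [Fin.sum_univ_two]

end Hamiltonian

/-! ### Transport of traces, positivity and density matrices (for mixed-state arguments) -/

section TraceAPI

variable {Λ : Type*} [LinearOrder Λ] [Fintype Λ]

/-- Entries of the inverse isomorphism. [cite: EsslerEtAl2005, §12.3.4 eq. (12.196)] -/
@[simp] theorem toSpin_symm_apply (B : Op Λ 4) (s s' : Finset (Orb Λ)) :
    toSpin.symm B s s' = B (siteConfig s) (siteConfig s') := by
  simp [toSpin]

/-- `toSpin` preserves traces. [cite: EsslerEtAl2005, §12.3.4 eq. (12.196)] -/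
theorem trace_toSpin (A : Matrix (Finset (Orb Λ)) (Finset (Orb Λ)) ℂ) : (toSpin A).trace = A.trace := by
  simp only [Matrix.trace, Matrix.diag_apply, toSpin_apply]
  exact Fintype.sum_equiv configEquiv _ _ fun k => rfl

/-- `toSpin` preserves positive semidefiniteness. [cite: EsslerEtAl2005, §12.3.4 eq. (12.196)] -/
theorem posSemidef_toSpin_iff (A : Matrix (Finset (Orb Λ)) (Finset (Orb Λ)) ℂ) :
    (toSpin A).PosSemidef ↔ A.PosSemidef := by
  have h : toSpin A = A.submatrix configEquiv configEquiv := by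
    ext k k'
    simp
  rw [h]
  exact Matrix.posSemidef_submatrix_equiv configEquiv

/-- `toSpin` preserves Hermiticity. [cite: EsslerEtAl2005, §12.3.4 eq. (12.196)] -/
theorem isHermitian_toSpin_iff (A : Matrix (Finset (Orb Λ)) (Finset (Orb Λ)) ℂ) :
    (toSpin A).IsHermitian ↔ A.IsHermitian := by
  constructor
  · intro h
    have h' : (toSpin A)ᴴ = toSpin A := h
    rw [← toSpin_conjTranspose] at h'
    exact toSpin.injective h'
  · intro h
    change (toSpin A)ᴴ = toSpin A
    rw [← toSpin_conjTranspose, h.eq]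

end TraceAPI

end JordanWigner

end Literature.MathematicalPhysics.QuantumLattice

end
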